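import Summits.MatrixMultiplication.MatrixMultiplication.Theorems.LevelGradedCohnUmansLevelOneGL2DesignsGaussianUnitalResidueRule

/-!
# Residue rules for the Gaussian unital lift, III: digit expansions — what a rule builds, and the
exponent `1/2` it cannot pass — stub `stub_tangencySets` (crux `LevelOneGL2Designs`,
stmt-MatrixMultiplication-14080), wall-breaker axis 10/12 "Hermitian unital constructions",
generation 1 (seat 3), cycle 2, part 8

Parts 6–7 (`…GaussianUnitalResidueCap`, `…GaussianUnitalResidueRule`) proved `|D|² ≤ m` for every
residue rule (digit set `D`, every class `(d − d') + mℤ`, `d ≠ d'`, free of `±(sums of two squares)`).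
This file records the construction the rules exist for, so that the cap is seen to bear on actual
norm-difference-free sets, and states the resulting ceiling:

* `sq_mul_eq_sq_add_sq_iff` — `M²·k` is a sum of two squares iff `k` is (`M ≥ 1`; Fermat–Euler);
* `normFree_digits` — in a SQUARE base `m = M²`, the `t`-digit expansions `Σ aᵢ mⁱ` (`aᵢ ∈ D ⊆ [0,m)`)
  of a residue rule form a set `A ⊆ [0, m^t)` of `|D|^t` integers no two of which differ by a sum of
  two squares (lowest differing digit: the rule; equal low digits: divide by the square `m`) — the
  input `U` of the Gaussian door of the lifted unital (seat 7-3, AXIS R8′: tangency sets of `AG(2,p)`,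
  `p ≡ 1 (mod 4)`, of size `≍ p·|U ∩ [0,√p)|`);
* `normFree_digits_card_sq_le` — and then `|A|² ≤ m^t`: whatever the base and the rule, residue-rule
  digit sets have exponent `≤ 1/2`, i.e. this door stops at `p^{5/4}` — the exponent the parabola
  lifts already give for all primes (`QuadraticLift`, axis k8);
* `normFree_digits_base_nine` — the extremal instance `m = 9`, `D = {0,3,6}`: `3^t` such integers in
  `[0, 9^t)` (certificate `3 ∥ d − d'`), attaining the cap.

Elementary given parts 6–7; no definitions.
-/

-- `Summit.MatrixMultiplication.MatrixMultiplication.…` is the tree's mandated summit/problem namespace (D-0017).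
set_option linter.dupNamespace false

namespace Summit.MatrixMultiplication.MatrixMultiplication.Theorems.LevelOneGL2Designs.GaussianUnital

open Finset

/-- **Square factors do not matter.**  For `M ≥ 1`, `M²·k` is a sum of two squares iff `k` is: the
exponents of the primes `q ≡ 3 (mod 4)` change by the even number `2·v_q(M)`. [Fermat–Euler,
`Nat.eq_sq_add_sq_iff`] -/
theorem sq_mul_eq_sq_add_sq_iff (M k : ℕ) (hM : M ≠ 0) :
    (∃ x y : ℕ, M ^ 2 * k = x ^ 2 + y ^ 2) ↔ ∃ x y : ℕ, k = x ^ 2 + y ^ 2 := by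
  refine ⟨fun h => ?_, fun ⟨x, y, hk⟩ => ⟨M * x, M * y, by rw [hk]; ring⟩⟩
  rcases Nat.eq_zero_or_pos k with rfl | hk
  · exact ⟨0, 0, by simp⟩
  rw [Nat.eq_sq_add_sq_iff] at h ⊢
  intro q hq hq3
  haveI := Fact.mk (Nat.prime_of_mem_primeFactors hq)
  have hM2 : M ^ 2 ≠ 0 := pow_ne_zero 2 hM
  have hq' : q ∈ (M ^ 2 * k).primeFactors := by
    rw [Nat.primeFactors_mul hM2 hk.ne']
    exact mem_union_right _ hq
  have := h q hq' hq3
  rw [padicValNat.mul hM2 hk.ne', padicValNat.pow M 2] at this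
  -- `Even (2 v + w) → Even w`
  rcases this with ⟨r, hr⟩
  exact ⟨r - padicValNat q M, by omega⟩

/-- **Digit expansions of a residue rule (square base).**  Let `m = M²` (`M ≥ 1`) and let
`D ⊆ [0, m)` be a residue rule: for `d ≠ d'` in `D` no `n ≡ d − d' (mod m)` has `|n|` a sum of two
squares.  Then for every `t` the `t`-digit expansions `Σ_{i<t} aᵢ mⁱ`, `aᵢ ∈ D`, form a set
`A ⊆ [0, m^t)` of exactly `|D|^t` integers NO TWO OF WHICH DIFFER BY A SUM OF TWO SQUARES — the sets
fed to the Gaussian door of the lifted unital.  (Two expansions first differing in digit `i₀` differ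
by `m^{i₀}·n` with `n ≡ a_{i₀} − a'_{i₀} (mod m)`; `m^{i₀}` is a square.) [elementary] -/
theorem normFree_digits (M : ℕ) (hM : 0 < M) (D : Finset ℤ)
    (hD : ∀ d ∈ D, 0 ≤ d ∧ d < ((M ^ 2 : ℕ) : ℤ))
    (hrule : ∀ d ∈ D, ∀ d' ∈ D, d ≠ d' → ∀ n : ℤ, ((M ^ 2 : ℕ) : ℤ) ∣ n - (d - d') →
      ¬ ∃ x y : ℕ, n.natAbs = x ^ 2 + y ^ 2)
    (t : ℕ) :
    ∃ A : Finset ℤ, A.card = D.card ^ t ∧ (∀ a ∈ A, 0 ≤ a ∧ a < ((M ^ 2 : ℕ) : ℤ) ^ t) ∧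
      ∀ a ∈ A, ∀ a' ∈ A, a ≠ a' → ¬ ∃ x y : ℕ, (a - a').natAbs = x ^ 2 + y ^ 2 := by
  classical
  -- the base, as an integer
  set mz : ℤ := ((M ^ 2 : ℕ) : ℤ) with hmzdef
  have hmz : (0 : ℤ) < mz := by rw [hmzdef]; exact_mod_cast pow_pos hM 2
  induction t with
  | zero =>
    refine ⟨{0}, by simp, fun a ha => ?_, fun a ha a' ha' hne => ?_⟩
    · rw [mem_singleton] at ha; subst ha; simp
    · rw [mem_singleton] at ha ha'; exact absurd (ha.trans ha'.symm) hne
  | succ t ih =>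
    obtain ⟨A, hAcard, hAbox, hAfree⟩ := ih
    -- `A' = {d + m·w : d ∈ D, w ∈ A}`, `m = M²`
    let F : ℤ × ℤ → ℤ := fun x => x.1 + mz * x.2
    have hinj : Set.InjOn F ↑(D ×ˢ A) := by
      rintro ⟨d, w⟩ hx ⟨d', w'⟩ hx' hF
      simp only [coe_product, Set.mem_prod, mem_coe] at hx hx'
      simp only [F] at hF
      obtain ⟨hd0, hdm⟩ := hD d hx.1
      obtain ⟨hd0', hdm'⟩ := hD d' hx'.1
      -- `d - d' = m (w' - w)` with `|d - d'| < m` forces `w = w'`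
      have hww : w = w' := by
        by_contra hww
        have h1 : (1 : ℤ) ≤ |w' - w| := Int.one_le_abs (sub_ne_zero.mpr (Ne.symm hww))
        have h2 : |d - d'| < mz := by
          rw [abs_sub_lt_iff]; constructor <;> linarith
        have h3 : d - d' = mz * (w' - w) := by linear_combination hF
        rw [h3, abs_mul, abs_of_pos hmz] at h2
        nlinarith
      subst hww
      have : d = d' := by linear_combination hF
      subst this
      rfl
    refine ⟨(D ×ˢ A).image F, ?_, ?_, ?_⟩
    · rw [card_image_of_injOn hinj, card_product, hAcard, pow_succ, mul_comm]
    · intro a ha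
      rw [mem_image] at ha
      obtain ⟨⟨d, w⟩, hx, rfl⟩ := ha
      rw [mem_product] at hx
      obtain ⟨hd0, hdm⟩ := hD d hx.1
      obtain ⟨hw0, hwm⟩ := hAbox w hx.2
      simp only [F]
      constructor
      · positivity
      · -- `d + m w ≤ (m - 1) + m (m^t - 1) < m^(t+1)`
        have h1 : d ≤ mz - 1 := by linarith [Int.lt_iff_add_one_le.mp hdm]
        have hw : w ≤ mz ^ t - 1 := by linarith [Int.lt_iff_add_one_le.mp hwm]
        have h2 : mz * w ≤ mz * (mz ^ t - 1) := mul_le_mul_of_nonneg_left hw hmz.le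
        calc d + mz * w ≤ (mz - 1) + mz * (mz ^ t - 1) := add_le_add h1 h2
          _ = mz ^ (t + 1) - 1 := by ring
          _ < mz ^ (t + 1) := sub_one_lt _
    · intro a ha a' ha' hne
      rw [mem_image] at ha ha'
      obtain ⟨⟨d, w⟩, hx, rfl⟩ := ha
      obtain ⟨⟨d', w'⟩, hx', rfl⟩ := ha'
      rw [mem_product] at hx hx'
      simp only [F]
      by_cases hdd : d = d'
      · -- equal low digits: the difference is `m (w - w')`, and `m` is a square
        subst hdd
        have hww : w ≠ w' := fun h => hne (by simp [F, h])
        rintro ⟨x, y, hxy⟩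
        apply hAfree w hx.2 w' hx'.2 hww
        rw [← sq_mul_eq_sq_add_sq_iff M _ hM.ne']
        refine ⟨x, y, ?_⟩
        rw [← hxy, show d + mz * w - (d + mz * w') = mz * (w - w') by ring,
          Int.natAbs_mul, hmzdef, Int.natAbs_natCast]
      · -- different low digits: the difference is `≡ d - d' (mod m)`: the rule
        exact hrule d hx.1 d' hx'.1 hdd _ ⟨w - w', by rw [hmzdef]; ring⟩

/-- **The ceiling of the method: exponent `1/2`.**  With `A` as in `normFree_digits` (any square base
`m = M²`, any residue rule `D`, any number `t` of digits), `|A|² = (|D|²)^t ≤ m^t`: residue-rule digit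
sets in `[0, N)`, `N = m^t`, never have more than `√N` elements, so the Gaussian door of the lifted
unital fed by them has at most `≍ p·(√p)^{1/2} = p^{5/4}` points. [parts 6–7 + `normFree_digits`] -/
theorem normFree_digits_card_sq_le (M : ℕ) (hM : 0 < M) (D : Finset ℤ)
    (hrule : ∀ d ∈ D, ∀ d' ∈ D, d ≠ d' → ∀ n : ℤ, ((M ^ 2 : ℕ) : ℤ) ∣ n - (d - d') →
      ¬ ∃ x y : ℕ, n.natAbs = x ^ 2 + y ^ 2)
    (t : ℕ) (A : Finset ℤ) (hA : A.card = D.card ^ t) :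
    A.card ^ 2 ≤ (M ^ 2) ^ t := by
  have h := card_sq_le_of_residueRule (M ^ 2) (pow_pos hM 2) D hrule
  calc A.card ^ 2 = (D.card ^ 2) ^ t := by rw [hA]; ring
    _ ≤ (M ^ 2) ^ t := Nat.pow_le_pow_left h t

/-- **Base `9`, digits `{0,3,6}` (the extremal rule for `q = 3`).**  For every `t` there are `3^t`
integers in `[0, 9^t)` no two of which differ by a sum of two squares — the digit set behind the
`p^{5/4}` of the Gaussian door (seat 7-3, R8′), here from `residueRule_of_certificate` with the
certificate `3 ∥ d − d'` and `normFree_digits`; `3^t = √(9^t)` is the cap. [elementary] -/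
theorem normFree_digits_base_nine (t : ℕ) :
    ∃ A : Finset ℤ, A.card = 3 ^ t ∧ (∀ a ∈ A, 0 ≤ a ∧ a < 9 ^ t) ∧
      ∀ a ∈ A, ∀ a' ∈ A, a ≠ a' → ¬ ∃ x y : ℕ, (a - a').natAbs = x ^ 2 + y ^ 2 := by
  obtain ⟨A, hcard, hbox, hfree⟩ := normFree_digits 3 (by norm_num) ({0, 3, 6} : Finset ℤ)
    (by intro d hd; simp only [mem_insert, mem_singleton] at hd; rcases hd with rfl | rfl | rfl <;>
          norm_num)
    (by
      intro d hd d' hd' hne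
      -- certificate `(3, 1)` below the precision of `9 = 3²`
      refine residueRule_of_certificate (q := 3) (k := 1) (by norm_num) (by norm_num) odd_one
        (by norm_num) ?_ ?_
      · simp only [mem_insert, mem_singleton] at hd hd'
        rcases hd with rfl | rfl | rfl <;> rcases hd' with rfl | rfl | rfl <;> norm_num
      · simp only [mem_insert, mem_singleton] at hd hd'
        rcases hd with rfl | rfl | rfl <;> rcases hd' with rfl | rfl | rfl <;>
          first | exact absurd rfl hne | norm_num)
    t
  refine ⟨A, by rw [hcard]; rfl, fun a ha => ?_, hfree⟩
  obtain ⟨h0, h1⟩ := hbox a ha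
  refine ⟨h0, ?_⟩
  have h9 : ((3 ^ 2 : ℕ) : ℤ) = 9 := by norm_num
  simpa [h9] using h1

end Summit.MatrixMultiplication.MatrixMultiplication.Theorems.LevelOneGL2Designs.GaussianUnital
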